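import Summits.NavierStokesRegularity.NavierStokesRegularity.Theorems.CoriolisHeadCounterRotatingLiouvilleCalculus
import Literature.Analysis.FluidPDE.TsaiGradientEstimate

/-!
# Route CoriolisHead · crux `CounterRotatingLiouville` (stmt-NavierStokesRegularity-22677) —
# towards stub 2 `stub_rssHeadGrowth`: Tsai's local gradient estimate (3.1) for rotated profiles

Support file of the line `tsai-rotating-head-chain` (theorems only; `--supports
stmt-NavierStokesRegularity-22677 --as helper`).  Port of the tree's `FluidPDE/TsaiGradientEstimate`
(Tsai 1998, Lemma 3.1) from Leray's system to the ROTATED profile system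
`−νΔU + aU + a(y·∇)U + (BU − (By·∇)U) + (U·∇)U + ∇P = 0`, `div U = 0`, `B` skew.  Testing the
system with `φU`, the Coriolis term drops out pointwise (`⟪BU, U⟫ = 0`) and the rotation drift
contributes one new term, `∫ φ ⟪DU(By), U⟫ = −½ ∫ Dφ(y)[By] |U|²`
(`integral_mul_inner_fderiv_apply_clm_eq`, the trilinear identity with the linear field `B`, of
divergence `tr B = 0`):

* `integral_mul_frobeniusNormSq_fderiv_eq_of_rotated` — the energy identity
  `ν ∫ φ |DU|² = (ν/2) ∫ Δφ |U|² + (a/2) ∫ φ |U|² + (a/2) ∫ Dφ(y)[y] |U|² + ½ ∫ Dφ(y)[U] |U|²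
   + ∫ (P − c) ⟪U, ∇φ⟫ − ½ ∫ Dφ(y)[By] |U|²`;
* `exists_gradient_estimate_consts_of_rotated` — (3.1) on balls with explicit constants, the
  rotation adding `‖B‖ C₁ (|x₀| + 2R)/(2R)` to the coefficient of `∫_{B̄(x₀,2R)} |U|²`.

NS regularity is NOT proved here.
-/

noncomputable section

-- the summit and its single sub-problem share the name (CONVENTIONS §1), as in every Theorems file
set_option linter.dupNamespace false

open MeasureTheory Set Function Filter Topology InnerProductSpace Metric
open scoped RealInnerProductSpace Laplacian ContDiff BigOperators ENNReal NNReal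
open Literature.Analysis.FluidPDE

namespace Summit.NavierStokesRegularity.NavierStokesRegularity.Theorems.CoriolisHead

section GradientEstimate

variable {ν a : ℝ} {B : EuclideanSpace ℝ (Fin 3) →L[ℝ] EuclideanSpace ℝ (Fin 3)}
  {U : (EuclideanSpace ℝ (Fin 3)) → (EuclideanSpace ℝ (Fin 3))} {P : (EuclideanSpace ℝ (Fin 3)) → ℝ}

/-- **`∫ φ ⟪DU(y)(By), U(y)⟫ dy = −½ ∫ Dφ(y)[By] |U|²`** for a skew continuous linear `B` (so
`div (y ↦ By) = tr B = 0`), `U ∈ C¹`, `φ ∈ C¹_c` (the trilinear identity with the field `B`). -/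
theorem integral_mul_inner_fderiv_apply_clm_eq (hB : ∀ x, ⟪B x, x⟫ = 0) (hU : ContDiff ℝ 1 U)
    {φ : (EuclideanSpace ℝ (Fin 3)) → ℝ} (hφ : ContDiff ℝ 1 φ) (hφc : HasCompactSupport φ) :
    ∫ x, φ x * ⟪fderiv ℝ U x (B x), U x⟫ =
      -(1 / 2) * ∫ x, fderiv ℝ φ x (B x) * ‖U x‖ ^ 2 := by
  have hW : ContDiff ℝ 1 fun x => φ x • U x := hφ.smul hU
  have hWc : HasCompactSupport fun x => φ x • U x := hφc.smul_right
  have key := integral_inner_convect_add_eq_zero (u := fun x : (EuclideanSpace ℝ (Fin 3)) => B x)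
    (v := U) (w := fun x => φ x • U x) B.contDiff hU hW hWc
  have hφd : Differentiable ℝ φ := hφ.differentiable one_ne_zero
  have hUd : Differentiable ℝ U := hU.differentiable one_ne_zero
  have h1 : ∀ x, ⟪convect (fun x : (EuclideanSpace ℝ (Fin 3)) => B x) U x, φ x • U x⟫ =
      φ x * ⟪fderiv ℝ U x (B x), U x⟫ := fun x => by rw [convect_apply, inner_smul_right]
  have h2 : ∀ x, ⟪U x, convect (fun x : (EuclideanSpace ℝ (Fin 3)) => B x) (fun x => φ x • U x) x⟫ =
      fderiv ℝ φ x (B x) * ‖U x‖ ^ 2 + φ x * ⟪fderiv ℝ U x (B x), U x⟫ := fun x => by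
    rw [convect_apply, fderiv_fun_smul (hφd x) (hUd x)]
    simp only [_root_.add_apply, _root_.FunLike.coe_smul, Pi.smul_apply,
      ContinuousLinearMap.smulRight_apply, inner_add_right, inner_smul_right,
      real_inner_self_eq_norm_sq, real_inner_comm (U x)]
    ring
  have h3 : ∀ x, VectorCalculus.divergence (fun x : (EuclideanSpace ℝ (Fin 3)) => B x) x *
      ⟪U x, φ x • U x⟫ = 0 := fun x => by
    rw [divergence_eq_traceCLM, show (fun x : EuclideanSpace ℝ (Fin 3) => B x) = (B : _ → _) from rfl,
      B.fderiv, traceCLM_eq_zero_of_skew hB, zero_mul]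
  simp_rw [h1, h2, h3] at key
  rw [integral_zero, add_zero] at key
  have iA : Integrable fun x => φ x * ⟪fderiv ℝ U x (B x), U x⟫ :=
    integrable_mul_of_hasCompactSupport_left hφ.continuous hφc
      (((hU.continuous_fderiv one_ne_zero).clm_apply B.continuous).inner hU.continuous)
  have iB : Integrable fun x => fderiv ℝ φ x (B x) * ‖U x‖ ^ 2 :=
    (((hφ.continuous_fderiv one_ne_zero).clm_apply B.continuous).mul (hU.continuous.norm.pow 2))
      |>.integrable_of_hasCompactSupport ((hφc.fderiv (𝕜 := ℝ)).mono fun x hx => by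
        contrapose! hx; simp only [mem_support, not_not] at hx; simp [hx])
  rw [integral_add iB iA] at key
  linarith

/-- **Energy identity for rotated profiles tested against `φU`** (port of
`IsLerayProfile.integral_mul_frobeniusNormSq_fderiv_eq`): for `U ∈ C^∞`, `P ∈ C²`, `B` skew,
`div U = 0`, the rotated system, `φ ∈ C²_c` and any constant `c`,
`ν ∫ φ |DU|² = (ν/2) ∫ Δφ |U|² + (a/2) ∫ φ |U|² + (a/2) ∫ Dφ(y)[y] |U|² + ½ ∫ Dφ(y)[U] |U|²
  + ∫ (P − c) ⟪U, ∇φ⟫ − ½ ∫ Dφ(y)[By] |U|²`. -/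
theorem integral_mul_frobeniusNormSq_fderiv_eq_of_rotated (hU : ContDiff ℝ ∞ U) (hP2 : ContDiff ℝ 2 P)
    (hB : ∀ x, ⟪B x, x⟫ = 0) (hdiv : VectorCalculus.IsDivFree U)
    (heq : ∀ y, -(ν • (Δ U) y) + a • U y + a • fderiv ℝ U y y + (B (U y) - fderiv ℝ U y (B y)) +
      convect U U y + gradient P y = 0)
    {φ : (EuclideanSpace ℝ (Fin 3)) → ℝ} (hφ : ContDiff ℝ 2 φ) (hφc : HasCompactSupport φ) (c : ℝ) :
    ν * ∫ x, φ x * frobeniusNormSq (fderiv ℝ U x) =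
      (ν / 2) * (∫ x, (Δ φ) x * ‖U x‖ ^ 2) + (a / 2) * (∫ x, φ x * ‖U x‖ ^ 2)
      + (a / 2) * (∫ x, fderiv ℝ φ x x * ‖U x‖ ^ 2)
      + (1 / 2) * (∫ x, fderiv ℝ φ x (U x) * ‖U x‖ ^ 2)
      + (∫ x, (P x - c) * ⟪U x, gradient φ x⟫)
      - (1 / 2) * (∫ x, fderiv ℝ φ x (B x) * ‖U x‖ ^ 2) := by
  have hU3 : ContDiff ℝ 3 U := hU.of_le (by norm_cast)
  have hU2 : ContDiff ℝ 2 U := hU.of_le (by norm_cast)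
  have hU1 : ContDiff ℝ 1 U := hU.of_le (by norm_cast)
  have hP1 : ContDiff ℝ 1 P := hP2.of_le one_le_two
  have hφ1 : ContDiff ℝ 1 φ := hφ.of_le one_le_two
  -- the system, paired with `φU`: `ν φ⟪ΔU,U⟫ = a φ|U|² + a φ⟪DU y y, U⟫ + φ⟪(U·∇)U, U⟫ + φ⟪∇P, U⟫`
  have hsys : ∀ x, ν * (φ x * ⟪(Δ U) x, U x⟫) = a * (φ x * ‖U x‖ ^ 2)
      + a * (φ x * ⟪fderiv ℝ U x x, U x⟫) - φ x * ⟪fderiv ℝ U x (B x), U x⟫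
      + φ x * ⟪convect U U x, U x⟫ + φ x * ⟪gradient P x, U x⟫ := fun x => by
    have hx := heq x
    have hΔ : ν • (Δ U) x = a • U x + a • fderiv ℝ U x x + (B (U x) - fderiv ℝ U x (B x)) +
        convect U U x + gradient P x := by
      rw [← sub_eq_zero, ← neg_eq_zero, ← hx]; abel
    have := congrArg (fun v => φ x * ⟪v, U x⟫) hΔ
    simp only [inner_smul_left, inner_add_left, inner_sub_left, RCLike.conj_to_real,
      real_inner_self_eq_norm_sq, hB (U x)] at this
    linarith
  have iLap : Integrable fun x => φ x * ⟪(Δ U) x, U x⟫ :=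
    integrable_mul_of_hasCompactSupport_left hφ.continuous hφc
      ((Literature.Analysis.FluidPDE.continuous_laplacian hU2).inner hU.continuous)
  have iSq : Integrable fun x => φ x * ‖U x‖ ^ 2 :=
    integrable_mul_of_hasCompactSupport_left hφ.continuous hφc (hU.continuous.norm.pow 2)
  have iDr : Integrable fun x => φ x * ⟪fderiv ℝ U x x, U x⟫ :=
    integrable_mul_of_hasCompactSupport_left hφ.continuous hφc
      (((hU1.continuous_fderiv one_ne_zero).clm_apply continuous_id).inner hU.continuous)
  have iRot : Integrable fun x => φ x * ⟪fderiv ℝ U x (B x), U x⟫ :=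
    integrable_mul_of_hasCompactSupport_left hφ.continuous hφc
      (((hU1.continuous_fderiv one_ne_zero).clm_apply B.continuous).inner hU.continuous)
  have iCv : Integrable fun x => φ x * ⟪convect U U x, U x⟫ :=
    integrable_mul_of_hasCompactSupport_left hφ.continuous hφc
      (((hU1.continuous_fderiv one_ne_zero).clm_apply hU.continuous).inner hU.continuous)
  have iPr : Integrable fun x => φ x * ⟪gradient P x, U x⟫ :=
    integrable_mul_of_hasCompactSupport_left hφ.continuous hφc
      ((continuous_gradient_of_contDiff hP1).inner hU.continuous)
  have hint : ν * (∫ x, φ x * ⟪(Δ U) x, U x⟫) = a * (∫ x, φ x * ‖U x‖ ^ 2)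
      + a * (∫ x, φ x * ⟪fderiv ℝ U x x, U x⟫) - (∫ x, φ x * ⟪fderiv ℝ U x (B x), U x⟫)
      + (∫ x, φ x * ⟪convect U U x, U x⟫) + ∫ x, φ x * ⟪gradient P x, U x⟫ := by
    rw [← integral_const_mul, ← integral_const_mul, ← integral_const_mul]
    rw [← integral_add, ← integral_sub, ← integral_add, ← integral_add]
    · exact integral_congr_ae (Eventually.of_forall hsys)
    · exact (((iSq.const_mul a).add (iDr.const_mul a)).sub iRot).add iCv
    · exact iPr
    · exact ((iSq.const_mul a).add (iDr.const_mul a)).sub iRot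
    · exact iCv
    · exact (iSq.const_mul a).add (iDr.const_mul a)
    · exact iRot
    · exact iSq.const_mul a
    · exact iDr.const_mul a
  have e1 := integral_mul_frobeniusNormSq_fderiv_eq_of_contDiff hU2 hφ hφc
  have e2 := integral_mul_inner_fderiv_apply_self_eq hU1 hφ1 hφc
  have e3 := integral_mul_inner_convect_self_eq hU1 hdiv hφ1 hφc
  have e4 := integral_mul_inner_gradient_eq hP1 hU1 hdiv hφ1 hφc c
  have eB := integral_mul_inner_fderiv_apply_clm_eq hB hU1 hφ1 hφc
  rw [e2, e3, e4, eB] at hint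
  rw [e1]
  linear_combination -hint

/-! ### (3.1) on balls -/

/-- **Tsai's gradient estimate (3.1) on balls for rotated profiles, explicit constants** (port of
`IsLerayProfile.exists_gradient_estimate_consts`): universal `C₁, C₂ ≥ 0` with
`ν ∫_{B(x₀,R)} |DU|² ≤ (νC₂/(2R²) + a/2 + (a + ‖B‖)C₁(|x₀| + 2R)/(2R)) ∫_{B̄(x₀,2R)} |U|²
  + (C₁/(2R)) ∫_{B̄(x₀,2R)} |U|³ + (C₁/R) ∫_{B̄(x₀,2R)} |P − c| |U|`. -/
theorem exists_gradient_estimate_consts_of_rotated :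
    ∃ C₁ C₂ : ℝ, 0 ≤ C₁ ∧ 0 ≤ C₂ ∧ ∀ {ν a : ℝ}
      {B : EuclideanSpace ℝ (Fin 3) →L[ℝ] EuclideanSpace ℝ (Fin 3)}
      {U : (EuclideanSpace ℝ (Fin 3)) → (EuclideanSpace ℝ (Fin 3))} {P : (EuclideanSpace ℝ (Fin 3)) → ℝ},
      ContDiff ℝ ∞ U → ContDiff ℝ 2 P → (∀ x, ⟪B x, x⟫ = 0) → VectorCalculus.IsDivFree U →
      (∀ y, -(ν • (Δ U) y) + a • U y + a • fderiv ℝ U y y + (B (U y) - fderiv ℝ U y (B y)) +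
        convect U U y + gradient P y = 0) → 0 ≤ ν → 0 ≤ a →
      ∀ {R : ℝ}, 0 < R → ∀ (x₀ : (EuclideanSpace ℝ (Fin 3))) (c : ℝ),
        ν * ∫ x in ball x₀ R, frobeniusNormSq (fderiv ℝ U x) ≤
          (ν * C₂ / (2 * R ^ 2) + a / 2 + (a + ‖B‖) * C₁ * (‖x₀‖ + 2 * R) / (2 * R)) *
              (∫ x in closedBall x₀ (2 * R), ‖U x‖ ^ 2)
            + C₁ / (2 * R) * (∫ x in closedBall x₀ (2 * R), ‖U x‖ ^ 3)
            + C₁ / R * ∫ x in closedBall x₀ (2 * R), |P x - c| * ‖U x‖ := by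
  obtain ⟨C₁, hC₁0, hC₁⟩ := exists_norm_fderiv_cutoff_le (E := (EuclideanSpace ℝ (Fin 3)))
  obtain ⟨C₂, hC₂0, hC₂⟩ := exists_abs_laplacian_cutoff_le (E := (EuclideanSpace ℝ (Fin 3)))
  refine ⟨C₁, C₂, hC₁0, hC₂0, fun {ν a B U P} hU hP2 hB hdiv heq hν ha {R} hR x₀ c => ?_⟩
  obtain ⟨hφ2, hφc, hφS, hφ01, hφ1, hDφ, hΔφ⟩ := cutoff_sub_props hC₁ hC₂ hR x₀
  set φ : (EuclideanSpace ℝ (Fin 3)) → ℝ := fun x => cutoff R (x - x₀) with hφd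
  have hUc : Continuous U := hU.continuous
  have hU2 : ContDiff ℝ 2 U := hU.of_le (by norm_cast)
  set S := closedBall x₀ (2 * R) with hSd
  have hS : MeasurableSet S := measurableSet_closedBall
  have hSc : IsCompact S := isCompact_closedBall _ _
  have hSR : ∀ x ∈ S, ‖x‖ ≤ ‖x₀‖ + 2 * R := fun x hx => by
    rw [hSd, mem_closedBall, dist_eq_norm] at hx
    calc ‖x‖ = ‖(x - x₀) + x₀‖ := by rw [sub_add_cancel]
      _ ≤ ‖x - x₀‖ + ‖x₀‖ := norm_add_le _ _
      _ ≤ 2 * R + ‖x₀‖ := by gcongr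
      _ = ‖x₀‖ + 2 * R := add_comm _ _
  -- the identity
  have hid := integral_mul_frobeniusNormSq_fderiv_eq_of_rotated hU hP2 hB hdiv heq hφ2 hφc c
  -- vanishing of `φ`, `Dφ`, `Δφ` off `S`
  have hφ0 : ∀ x ∉ S, φ x = 0 := fun x hx => image_eq_zero_of_notMem_tsupport fun h => hx (hφS h)
  have hDφ0 : ∀ x ∉ S, fderiv ℝ φ x = 0 := fun x hx => fderiv_of_notMem_tsupport ℝ fun h => hx (hφS h)
  have hΔφ0 : ∀ x ∉ S, (Δ φ) x = 0 := fun x hx => laplacian_eq_zero_of_notMem_tsupport fun h => hx (hφS h)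
  -- local integrals of `U`
  have hI2 : IntegrableOn (fun x => ‖U x‖ ^ 2) S := (hUc.norm.pow 2).continuousOn.integrableOn_compact hSc
  have hI3 : IntegrableOn (fun x => ‖U x‖ ^ 3) S := (hUc.norm.pow 3).continuousOn.integrableOn_compact hSc
  have hP1 : ContDiff ℝ 1 P := hP2.of_le one_le_two
  have hIP : IntegrableOn (fun x => |P x - c| * ‖U x‖) S :=
    (((hP1.continuous.sub continuous_const).abs).mul hUc.norm).continuousOn.integrableOn_compact hSc
  set J₂ := ∫ x in S, ‖U x‖ ^ 2 with hJ₂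
  set J₃ := ∫ x in S, ‖U x‖ ^ 3 with hJ₃
  set JP := ∫ x in S, |P x - c| * ‖U x‖ with hJP
  have hJ₂0 : 0 ≤ J₂ := integral_nonneg fun x => by positivity
  have hJ₃0 : 0 ≤ J₃ := integral_nonneg fun x => by positivity
  have hJP0 : 0 ≤ JP := integral_nonneg fun x => by positivity
  have hC₁R : 0 ≤ C₁ / R := div_nonneg hC₁0 hR.le
  -- term bounds
  have t1 : |∫ x, (Δ φ) x * ‖U x‖ ^ 2| ≤ C₂ / R ^ 2 * J₂ := by
    refine abs_integral_le_of_support_subset hS (fun x hx => by rw [hΔφ0 x hx, zero_mul])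
      (fun x _ => ?_) hI2
    rw [abs_mul, abs_pow, abs_norm]
    exact mul_le_mul_of_nonneg_right (hΔφ x) (by positivity)
  have t2 : |∫ x, φ x * ‖U x‖ ^ 2| ≤ 1 * J₂ := by
    refine abs_integral_le_of_support_subset hS (fun x hx => by rw [hφ0 x hx, zero_mul])
      (fun x _ => ?_) hI2
    rw [abs_mul, abs_pow, abs_norm, abs_of_nonneg (hφ01 x).1]
    exact mul_le_mul_of_nonneg_right (hφ01 x).2 (by positivity)
  have t3 : |∫ x, fderiv ℝ φ x x * ‖U x‖ ^ 2| ≤ C₁ / R * (‖x₀‖ + 2 * R) * J₂ := by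
    refine abs_integral_le_of_support_subset hS
      (fun x hx => by rw [hDφ0 x hx, _root_.zero_apply, zero_mul]) (fun x hx => ?_) hI2
    rw [abs_mul, abs_pow, abs_norm]
    refine mul_le_mul_of_nonneg_right ?_ (by positivity)
    rw [← Real.norm_eq_abs]
    calc ‖fderiv ℝ φ x x‖ ≤ ‖fderiv ℝ φ x‖ * ‖x‖ := ContinuousLinearMap.le_opNorm _ _
      _ ≤ C₁ / R * (‖x₀‖ + 2 * R) := mul_le_mul (hDφ x) (hSR x hx) (norm_nonneg _) hC₁R
  have tB : |∫ x, fderiv ℝ φ x (B x) * ‖U x‖ ^ 2| ≤ C₁ / R * ‖B‖ * (‖x₀‖ + 2 * R) * J₂ := by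
    refine abs_integral_le_of_support_subset hS
      (fun x hx => by rw [hDφ0 x hx, _root_.zero_apply, zero_mul]) (fun x hx => ?_) hI2
    rw [abs_mul, abs_pow, abs_norm]
    refine mul_le_mul_of_nonneg_right ?_ (by positivity)
    rw [← Real.norm_eq_abs]
    calc ‖fderiv ℝ φ x (B x)‖ ≤ ‖fderiv ℝ φ x‖ * ‖B x‖ := ContinuousLinearMap.le_opNorm _ _
      _ ≤ C₁ / R * (‖B‖ * ‖x‖) := mul_le_mul (hDφ x) (B.le_opNorm x) (norm_nonneg _) hC₁R
      _ ≤ C₁ / R * (‖B‖ * (‖x₀‖ + 2 * R)) := by gcongr; exact hSR x hx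
      _ = C₁ / R * ‖B‖ * (‖x₀‖ + 2 * R) := by ring
  have t4 : |∫ x, fderiv ℝ φ x (U x) * ‖U x‖ ^ 2| ≤ C₁ / R * J₃ := by
    refine abs_integral_le_of_support_subset hS
      (fun x hx => by rw [hDφ0 x hx, _root_.zero_apply, zero_mul]) (fun x _ => ?_) hI3
    rw [abs_mul, abs_pow, abs_norm]
    have hD : |fderiv ℝ φ x (U x)| ≤ C₁ / R * ‖U x‖ := by
      rw [← Real.norm_eq_abs]
      calc ‖fderiv ℝ φ x (U x)‖ ≤ ‖fderiv ℝ φ x‖ * ‖U x‖ := ContinuousLinearMap.le_opNorm _ _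
        _ ≤ C₁ / R * ‖U x‖ := by gcongr; exact hDφ x
    calc |fderiv ℝ φ x (U x)| * ‖U x‖ ^ 2 ≤ (C₁ / R * ‖U x‖) * ‖U x‖ ^ 2 := by gcongr
      _ = C₁ / R * ‖U x‖ ^ 3 := by ring
  have t5 : |∫ x, (P x - c) * ⟪U x, gradient φ x⟫| ≤ C₁ / R * JP := by
    refine abs_integral_le_of_support_subset hS (fun x hx => ?_) (fun x _ => ?_) hIP
    · rw [gradient_eq_zero_of_notMem_tsupport fun h => hx (hφS h), inner_zero_right, mul_zero]
    · rw [abs_mul]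
      have hg : ‖gradient φ x‖ ≤ C₁ / R := by
        rw [gradient, LinearIsometryEquiv.norm_map]; exact hDφ x
      calc |P x - c| * |⟪U x, gradient φ x⟫| ≤ |P x - c| * (‖U x‖ * ‖gradient φ x‖) :=
            mul_le_mul_of_nonneg_left (abs_real_inner_le_norm _ _) (abs_nonneg _)
        _ ≤ |P x - c| * (‖U x‖ * (C₁ / R)) := by gcongr
        _ = C₁ / R * (|P x - c| * ‖U x‖) := by ring
  -- left-hand side: `∫_{B(x₀,R)} |DU|² ≤ ∫ φ |DU|²`
  have hfrob : Continuous fun x => frobeniusNormSq (fderiv ℝ U x) :=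
    continuous_frobeniusNormSq_fderiv hU2 two_ne_zero
  have hLHS : ∫ x in ball x₀ R, frobeniusNormSq (fderiv ℝ U x) ≤
      ∫ x, φ x * frobeniusNormSq (fderiv ℝ U x) := by
    rw [← integral_indicator measurableSet_ball]
    refine integral_mono ?_ ?_ fun x => ?_
    · exact (hfrob.continuousOn.integrableOn_compact (isCompact_closedBall x₀ R)).mono_set
        ball_subset_closedBall |>.integrable_indicator measurableSet_ball
    · exact integrable_mul_of_hasCompactSupport_left hφ2.continuous hφc hfrob
    · by_cases hx : x ∈ ball x₀ R
      · have hx1 : φ x = 1 := hφ1 x (ball_subset_closedBall hx)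
        rw [indicator_of_mem hx, hx1, one_mul]
      · rw [indicator_of_notMem hx]
        exact mul_nonneg (hφ01 x).1 (frobeniusNormSq_nonneg _)
  -- assemble
  have hmain : ν * ∫ x, φ x * frobeniusNormSq (fderiv ℝ U x) ≤
      (ν * C₂ / (2 * R ^ 2) + a / 2 + (a + ‖B‖) * C₁ * (‖x₀‖ + 2 * R) / (2 * R)) * J₂
        + C₁ / (2 * R) * J₃ + C₁ / R * JP := by
    rw [hid]
    have e1 := (le_abs_self _).trans t1
    have e2 := (le_abs_self _).trans t2
    have e3 := (le_abs_self _).trans t3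
    have e4 := (le_abs_self _).trans t4
    have e5 := (le_abs_self _).trans t5
    have e6' : -(∫ x, fderiv ℝ φ x (B x) * ‖U x‖ ^ 2) ≤ C₁ / R * ‖B‖ * (‖x₀‖ + 2 * R) * J₂ :=
      (neg_le_abs _).trans tB
    have m1 := mul_le_mul_of_nonneg_left e1 (by positivity : 0 ≤ ν / 2)
    have m2 := mul_le_mul_of_nonneg_left e2 (by positivity : 0 ≤ a / 2)
    have m3 := mul_le_mul_of_nonneg_left e3 (by positivity : 0 ≤ a / 2)
    have m4 := mul_le_mul_of_nonneg_left e4 (by positivity : (0 : ℝ) ≤ 1 / 2)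
    have m6 := mul_le_mul_of_nonneg_left e6' (by positivity : (0 : ℝ) ≤ 1 / 2)
    have hsum := add_le_add (add_le_add (add_le_add (add_le_add (add_le_add m1 m2) m3) m4) e5) m6
    refine le_trans (le_of_eq (by ring)) (hsum.trans (le_of_eq ?_))
    field_simp
    ring
  calc ν * ∫ x in ball x₀ R, frobeniusNormSq (fderiv ℝ U x)
      ≤ ν * ∫ x, φ x * frobeniusNormSq (fderiv ℝ U x) := mul_le_mul_of_nonneg_left hLHS hν
    _ ≤ _ := hmain

end GradientEstimate

end Summit.NavierStokesRegularity.NavierStokesRegularity.Theorems.CoriolisHead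

end
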